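import Summits.Schanuel.Schanuel.Theorems.RootDecomp1KW4Dossier01

/-!
# RootDecomp1KLevelSieve (part 01 of 03) — CENSUS PROVENANCE for lens-1 g73 NODE 34 «THE LEVEL SIEVE IN THE KERNEL — the levels `s_N` are an ARITHMETIC PROGRESSION mod every odd prime» (NODE L3299, filed as a ×0-AS-RECORD INSTRUMENT under PRICE LIST L3259 (2)(f) / K-R52, no CLAIM, no credit asked; crit-1 (g14) PRICE + AUDIT NODE 34 L3303: ACCEPTED AS FILED, PORT WELCOME)

(census-1 g28 ×0 record port, `--supports stmt-Schanuel-33364`, no credit to anyone.  SOURCE: the lens's kernel HOME/decomp-schanuel-lens-1/g73/lean/LevelSieve.lean sha256 d72358039f5fbbb0bcbbeb9dcfb2a61a5398dbdeb70384e02eaa4b23b3e8ab6a (880 l; ONE import `…RootDecomp1KW4Dossier01`; ONE namespace `…Theorems.RootDecomp1KLevelSieve`; 48 theorems + 4 defs + 1 abbrev; lens farm rc 0 · 0 sorries; crit-1 (g14) PRICE + AUDIT NODE 34 L3303: «VERDICT ×0-AS-RECORD INSTRUMENT under L3259 (2)(f) / RULE K-R52 — ACCEPTED AS FILED … PORT WELCOME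 as a ×0 record port», farm rc 0, `--axioms no_level_W4P_upto` standard, probe rc 0 / CTRL rc 1, W4 numerics re-certified) split by the census at the §3/§4 boundary and inside §5 for the 400-line cap: part 01 = K l.1–308 (module docstring; §1 the two charts `affine_point_at` / `topForm_root_at`; §2 the one-residue engine `FibreEmptyAt`, `ratPoint_free_of_fibreEmptyAt`; §3 the level residue and the AP law `levelQ` / `levelRes` / `Bshift` / `psNumer_two_zmod` / `levelRes_eq_AP` / `no_level_of_fibreEmptyAt_AP`); part 02 = K l.309–443 (§4 W4: `W4FibreEmpty`, the shifts `Bshift_*`, the empty classes `w4FibreEmpty_*`, the seven progressions `no_level_W4P_mod5…23`) + the FIRST HALF of §5's certificate table; part 03 = the SECOND HALF + K l.852–878 (`levelSet_W4P_zero_or_gt`, `levelSet_W4P_avoids`, `level_zero_W4P_occupied`); parts 02 / 03 re-open the header (noncomputable section / namespace / the 11 `open` lines = K l.71–88 verbatim) behind `import …RootDecomp1KLevelSieve0(k−1)`.  Bodies BYTE-VERBATIM; port-side modifier (m1) = CAP EDITION of the one 405-line declaration `no_level_W4P_upto` (K l.446–850, a single `interval_cases N` with 400 bullets): the bullets are split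 200/200, byte-verbatim and in order, into `no_level_W4P_upto_low` (`1 ≤ N ≤ 200`, part 02) and `no_level_W4P_upto_high` (`201 ≤ N ≤ 400`, part 03), and `no_level_W4P_upto` is re-derived from the two in three lines with its STATEMENT AND DOCSTRING BYTE-IDENTICAL (reshape rule of the cap edition L2263 / L2264); nothing else renamed or changed.  Rung 0; nothing here proves Schanuel, 33364, 33363, 31077, 31987, `ThinFibre 2`, W4 or a binder — level 0 of W4 stays occupied and row 36 stays UNDECIDED OF RECORD.)
-/

/-!
# RootDecomp1KLevelSieve — lens 1, generation 73: NODE 34 «THE LEVEL SIEVE — the levels `s_N` form an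
ARITHMETIC PROGRESSION modulo every odd prime»

×0-AS-RECORD INSTRUMENT under crit price list L3259 (2)(f) and K-R52 (no credit asked; port welcome).
W4 (LIVENESS row 36, `W4P = (Y⁴ − 17)x² + (Y³ + 1)x + (Y + 2)`) stays the one UNDECIDED specimen of record:
nothing in this file discharges `ThinFibreAt 2 W4P`; see §6 of the node memo for why (Subspace, `n = 3`).

## The observation (§2–§3)

Write `s_N = p_N / 2^{N!}` with `p_N = psNumer 2 N = Σ_{i ≤ N} 2^{N! − i!}` (tree: `RootDecomp1KTwoBaseCell.psNumer`,
`RootDecomp1KParamThueMahler.partialSum_two_eq_ratCast`).  Node 21 (`RootDecomp1KOddEmpty`, the odd-place engine)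
is LEVEL-BLIND: it uses the levels only through `den s_N ∣ 2^{N!}` and therefore can only ever empty a curve ALL of
whose odd-place fibres are empty (`OddEmptyAt`) — which W4 is not (level `0` carries the point `(1/2, 1)`,
`RootDecomp1KW4Dossier.zero_mem_levelSet_W4P`).  The present node makes the odd place LEVEL-SENSITIVE through one
elementary identity: for an odd prime `ℓ` and every `N ≥ ℓ − 1`,

  `2^{N!} ≡ 1 (mod ℓ)`  and  `p_N ≡ N + B_ℓ (mod ℓ)`,  `B_ℓ := 2 + Σ_{i < ℓ−1} 2^{(ℓ−1) − (i! mod (ℓ−1))}`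

(`two_pow_factorial`, `psNumer_two_zmod`, `levelRes_eq_AP`): past `N = ℓ − 2` the reduction of the level `s_N` modulo
`ℓ` walks through the residues `0, 1, …, ℓ − 1` with step exactly `1`.  Consequently every residue class `a (mod ℓ)`
whose fibre `{y ∈ 𝔽_ℓ : P(a, y) = 0}` is empty (and which is not a root of the top `Y`-form — chart 2) kills the
whole arithmetic progression of levels `N ≡ a − B_ℓ (mod ℓ)`, `N ≥ ℓ − 1` (`no_level_of_fibreEmptyAt_AP`, any
curve; `FibreEmptyAt` is the one-residue refinement of node 21's `OddEmptyAt`, `fibreEmptyAt_of_oddEmptyAt`).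
For `N < ℓ − 1` the residue is still computable WITHOUT large numbers through Fermat exponent reduction
(`levelRes_mul_pow`, `levelRes_eq_of_sum`: exponents reduced `mod (ℓ − 1)`), which is what makes a kernel-checked
finite-range certificate possible where the census (LEVELSET-v2, L3286) had to stop at `N = 5` for want of a
720-bit factorisation.  NUMERICALLY this reduced-residue certificate is the writer's instrument LSW-v1 Method B
(L3288; replicated by the census `modcert.py` L3290 and the critic L3292: `LS(W4) ∩ [0, 5000] = {0}` as
three-instrument DATA, «still ×0 toward any verdict»); the present file adds nothing to those numerics — its content
is (i) the KERNEL form (theorems, not instrument output), (ii) the PROGRESSION LAW behind the table: for `N ≥ ℓ − 1`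
the `ℓ`-certificate of level `N` depends only on `N mod ℓ`, so the LSW-certifiable levels are eventually PERIODIC and
come in whole arithmetic progressions — infinitely many empty levels per empty class, not a finite range — and
(iii) the typed one-residue engine for every curve `Σ_j c_j(Y) x^j`.

## What it gives for W4 (§4–§5), hypothesis-free

* the empty W4 classes (`W4FibreEmpty ℓ a`, decided in `𝔽_ℓ`): `ℓ = 5: {2}`, `7: {6}`, `11: {2,7,9,10}`, `13: {4,12}`,
  `17: {2,3,11,12,14,16}`, `19: {7,15,17,18}`, `23: {3,4,7,10,11,15,20,21,22}`; shifts `B_5 = 1`, `B_7 = 1`, `B_11 = 3`,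
  `B_13 = 7`, `B_17 = 15`, `B_19 = 11`, `B_23 = 1`;
* hence the LEVELS `N ≡ 1 (5)` (`N ≥ 4`), `N ≡ 5 (7)` (`N ≥ 6`), `N ≡ 4,6,7,10 (11)` (`N ≥ 10`), `N ≡ 5,10 (13)` (`N ≥ 12`),
  `N ≡ 1,4,5,13,14,16 (17)` (`N ≥ 16`), `N ≡ 4,6,7,15 (19)` (`N ≥ 18`), `N ≡ 2,3,6,9,10,14,19,20,21 (23)` (`N ≥ 22`) carry NO rational
  point of W4 at all (`no_level_W4P_mod5` … `no_level_W4P_mod23`) — infinitely many levels, a set of asymptotic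
  density `1 − (4·6·7·11·11·15·14)/(5·7·11·13·17·19·23) = 1 − 11088/96577 = 0.885…` settled by seven finite-field
  computations;
* the finite range: `LS(W4) ∩ [1, 400] = ∅` (`no_level_W4P_upto`, one certificate prime `ℓ_N ≤ 61` per level, all by
  `decide` in `𝔽_ℓ`; levels `2,3,4,5,7,8,9,13,14,20,24,27` need the Fermat-reduced direct evaluation, the other 387 sit
  on a progression `N ≥ ℓ − 1`) — the kernel counterpart of the first 400 entries of LSW-v1's W4 row (instrument:
  `[0, 5000]`); the accompanying script (`g73/sieve/`, primes `≤ 401`) reports a surviving upper density `≤ 5.7 · 10⁻¹⁶`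
  for the levels not killed by some prime `≤ 401` — numerics, not part of this file;
* level-set corollaries (`levelSet_W4P_*`): an element of any `LevelSet W4P C` is `0` or exceeds `400`, and avoids the
  seven families of progressions.

## What it does NOT give (honest ×0)

A sieve by residue classes removes a density-zero-complement but never the last level: level `0` IS a global point, so
no finite set of primes empties every class, and «infinitely many independent local conditions ⇒ finitely many levels»
is the Borel–Cantelli heuristic, not a theorem.  `ThinFibreAt 2 W4P` (equivalently, here, `LevelFinite W4P` beyond an
explicit bound) remains exactly as hard as recorded (crit L3280: Subspace with `n = 3`; every one-function Roth/Ridout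
projection of W4 is Dirichlet-critical, exponent `2` against `2`; the two-target Ridout budget falls short by `2^{(N−1)!}`).
The instrument's use is different: it converts «is level `N` occupied?» from a 2^{N!}-size factoring problem into
`O(ℓ)` arithmetic in `𝔽_ℓ` for a positive-density set of `N`, and it is the first place in the tree where the INDEX `N` of
a level (not only its denominator `2^{N!}`) is read at an odd place.

Conventions: one namespace, one tree import, no instances / notation / options; `decide` only on `ZMod ℓ` goals with
`ℓ ≤ 61` and exponents `< ℓ`; every statement is hypothesis-free.
-/

noncomputable section

open Polynomial LiouvilleNumber
open scoped Nat

namespace Summit.Schanuel.Schanuel.Theorems.RootDecomp1KLevelSieve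

open Summit.Schanuel.Schanuel.Theorems.RootDecomp1KTwoBaseCell (psNumer partialSum_eq_psNumer_div coprime_psNumer)
open Summit.Schanuel.Schanuel.Theorems.RootDecomp1KDegreeLadder
open Summit.Schanuel.Schanuel.Theorems.RootDecomp1KXLinear
open Summit.Schanuel.Schanuel.Theorems.RootDecomp1KXLinearII
open Summit.Schanuel.Schanuel.Theorems.RootDecomp1KXTop
open Summit.Schanuel.Schanuel.Theorems.RootDecomp1KXAll
open Summit.Schanuel.Schanuel.Theorems.RootDecomp1KLevelFinite
open Summit.Schanuel.Schanuel.Theorems.RootDecomp1KDescent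
open Summit.Schanuel.Schanuel.Theorems.RootDecomp1KParamThueMahler (partialSum_two_eq_ratCast)
open Summit.Schanuel.Schanuel.Theorems.RootDecomp1KOddEmpty
open Summit.Schanuel.Schanuel.Theorems.RootDecomp1KW4Dossier

/-! ### §1 The two charts of node 21 with the residue made explicit -/

/-- Chart 1 (`ℓ ∤ den x`, `ℓ ∤ den r`) at the EXPLICIT residue `x̄ = num x / den x ∈ 𝔽_ℓ`: a rational point reduces to an
affine `𝔽_ℓ`-point in the fibre over `x̄` (node 21's `affine_point_of_ratPoint` hides `x̄` behind an `∃`). -/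
theorem affine_point_at {ℓ : ℕ} [Fact ℓ.Prime] (k : ℕ) (c : ℕ → ℤ[X]) {n : ℕ}
    (hn : ∀ j, j ≤ k → (c j).natDegree ≤ n) {x r : ℚ} (hP : bev (xPolyP k c) x r = 0)
    (hx : ¬ ℓ ∣ x.den) (hden : ¬ ℓ ∣ r.den) :
    ∑ j ∈ Finset.range (k + 1), (((x.num : ℤ) : ZMod ℓ) / (x.den : ZMod ℓ)) ^ j *
      aeval (((r.num : ℤ) : ZMod ℓ) / (r.den : ZMod ℓ)) (c j) = 0 := by
  have hq := natCast_ne_zero_zmod_of_not_dvd hx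
  have hd := natCast_ne_zero_zmod_of_not_dvd hden
  have key := cast_pointSum (K := ZMod ℓ) k c hn x r hq hd
  rw [pointSum_eq_zero k c hn hP, Int.cast_zero] at key
  rcases mul_eq_zero.mp key.symm with h | h
  · exact absurd h (mul_ne_zero (pow_ne_zero _ hq) (pow_ne_zero _ hd))
  · exact h

/-- Chart 2 (`ℓ ∤ den x`, `ℓ ∣ den r`) at the explicit residue: `x̄ = num x / den x` is a root of the top `Y`-form
`Σ_j [Yⁿ]c_j · x̄^j` (node 21's `topForm_root_of_ratPoint`, witness exposed). -/
theorem topForm_root_at {ℓ : ℕ} [Fact ℓ.Prime] (k : ℕ) (c : ℕ → ℤ[X]) {n : ℕ}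
    (hn : ∀ j, j ≤ k → (c j).natDegree ≤ n) {x r : ℚ} (hP : bev (xPolyP k c) x r = 0)
    (hx : ¬ ℓ ∣ x.den) (hden : ℓ ∣ r.den) :
    ∑ j ∈ Finset.range (k + 1), (((x.num : ℤ) : ZMod ℓ) / (x.den : ZMod ℓ)) ^ j *
      (((c j).coeff n : ℤ) : ZMod ℓ) = 0 := by
  have hq : (x.den : ZMod ℓ) ≠ 0 := natCast_ne_zero_zmod_of_not_dvd hx
  have hu := num_ne_zero_zmod_of_dvd_den r hden
  have hdZ : (ℓ : ℤ) ∣ (r.den : ℤ) := Int.natCast_dvd_natCast.mpr hden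
  have h := congrArg (Int.cast : ℤ → ZMod ℓ) (pointSum_eq_zero k c hn hP)
  simp only [Int.cast_sum, Int.cast_mul, Int.cast_pow, Int.cast_zero, Int.cast_natCast,
    cast_hf_of_dvd _ n hdZ] at h
  have key : ∑ j ∈ Finset.range (k + 1), ((x.num : ℤ) : ZMod ℓ) ^ j * (x.den : ZMod ℓ) ^ (k - j) *
      ((((c j).coeff n : ℤ) : ZMod ℓ) * ((r.num : ℤ) : ZMod ℓ) ^ n) =
      (x.den : ZMod ℓ) ^ k * ((r.num : ℤ) : ZMod ℓ) ^ n *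
        ∑ j ∈ Finset.range (k + 1), (((x.num : ℤ) : ZMod ℓ) / (x.den : ZMod ℓ)) ^ j *
          (((c j).coeff n : ℤ) : ZMod ℓ) := by
    rw [Finset.mul_sum]
    refine Finset.sum_congr rfl fun j hj => ?_
    have hjk : j ≤ k := Nat.lt_succ_iff.mp (Finset.mem_range.mp hj)
    rw [div_pow]
    have : (x.den : ZMod ℓ) ^ k = (x.den : ZMod ℓ) ^ (k - j) * (x.den : ZMod ℓ) ^ j := by
      rw [← pow_add, Nat.sub_add_cancel hjk]
    rw [this]; field_simp
  rw [key] at h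
  rcases mul_eq_zero.mp h with h1 | h1
  · exact absurd h1 (mul_ne_zero (pow_ne_zero _ hq) (pow_ne_zero _ hu))
  · exact h1

/-! ### §2 The one-residue engine `FibreEmptyAt` -/

/-- [class] definition (census convention): **FIBRE-EMPTINESS DATUM AT ONE RESIDUE** `a ∈ 𝔽_ℓ` (the level-sensitive refinement of node 21's `OddEmptyAt`,
which asks this for every `a` at once): `P = Σ_{j ≤ k} c_j(Y) x^j` with `deg c_j ≤ n`, `ℓ` prime, the affine fibre
over `a` is empty (`∀ y, Σ_j a^j c_j(y) ≠ 0` in `𝔽_ℓ`) and `a` is not a root of the top form `Σ_j [Yⁿ]c_j a^j`. -/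
def FibreEmptyAt (ℓ : ℕ) (P : ℤ[X][X]) (a : ZMod ℓ) : Prop :=
  ∃ (k : ℕ) (c : ℕ → ℤ[X]) (n : ℕ), P = xPolyP k c ∧ (∀ j, j ≤ k → (c j).natDegree ≤ n) ∧ ℓ.Prime ∧
    (∀ y : ZMod ℓ, ∑ j ∈ Finset.range (k + 1), a ^ j * aeval y (c j) ≠ 0) ∧
    (∑ j ∈ Finset.range (k + 1), a ^ j * (((c j).coeff n : ℤ) : ZMod ℓ) ≠ 0)

/-- `OddEmptyAt` is `FibreEmptyAt` at every residue. -/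
theorem fibreEmptyAt_of_oddEmptyAt {ℓ : ℕ} {P : ℤ[X][X]} (h : OddEmptyAt ℓ P) (a : ZMod ℓ) :
    FibreEmptyAt ℓ P a := by
  obtain ⟨k, c, n, hP, hn, hp, -, haff, htop⟩ := h
  exact ⟨k, c, n, hP, hn, hp, fun y => haff a y, htop a⟩

/-- **The engine.** An empty fibre at `a` excludes every rational point `(x, r)` with `ℓ ∤ den x` and `x ≡ a (mod ℓ)`. -/
theorem ratPoint_free_of_fibreEmptyAt {ℓ : ℕ} [Fact ℓ.Prime] {P : ℤ[X][X]} {a : ZMod ℓ}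
    (h : FibreEmptyAt ℓ P a) (x r : ℚ) (hx : ¬ ℓ ∣ x.den)
    (hxa : ((x.num : ℤ) : ZMod ℓ) / (x.den : ZMod ℓ) = a) : bev P x r ≠ 0 := by
  obtain ⟨k, c, n, rfl, hn, -, haff, htop⟩ := h
  intro hP
  by_cases hden : ℓ ∣ r.den
  · have h2 := topForm_root_at k c hn hP hx hden
    rw [hxa] at h2
    exact htop h2
  · have h1 := affine_point_at k c hn hP hx hden
    rw [hxa] at h1
    exact haff _ h1

/-! ### §3 The level residue and the arithmetic-progression law -/

/-- The level `s_N = p_N / 2^{N!}` as a rational number. -/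
def levelQ (N : ℕ) : ℚ := (psNumer 2 N : ℚ) / 2 ^ N !

/-- `partialSum 2 N = levelQ N` (tree: `partialSum_two_eq_ratCast`). -/
theorem partialSum_two_eq_levelQ (N : ℕ) : partialSum 2 N = ((levelQ N : ℚ) : ℝ) :=
  partialSum_two_eq_ratCast N

/-- The residue of the level `s_N` in `𝔽_ℓ` (`ℓ` an odd prime): `num s_N / den s_N`. -/
def levelRes (ℓ : ℕ) [Fact ℓ.Prime] (N : ℕ) : ZMod ℓ :=
  (((levelQ N).num : ℤ) : ZMod ℓ) / ((levelQ N).den : ZMod ℓ)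

/-- **Levels through the engine.** An empty fibre at the level residue empties the level (any curve). -/
theorem no_level_of_fibreEmptyAt {ℓ : ℕ} [Fact ℓ.Prime] {P : ℤ[X][X]} {N : ℕ}
    (h : FibreEmptyAt ℓ P (levelRes ℓ N)) (hℓ : ℓ ≠ 2) (r : ℚ) : bev P (partialSum 2 N) r ≠ 0 := by
  rw [partialSum_two_eq_levelQ]
  exact ratPoint_free_of_fibreEmptyAt h _ r (not_dvd_den_level Fact.out hℓ N) rfl

/-- `num s_N = p_N` and `den s_N = 2^{N!}` for `N ≥ 2` (`p_N` is odd). -/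
theorem levelQ_num_den {N : ℕ} (hN : 2 ≤ N) :
    (levelQ N).num = psNumer 2 N ∧ (levelQ N).den = 2 ^ N ! := by
  have hcop : Nat.Coprime ((psNumer 2 N : ℕ) : ℤ).natAbs ((2 : ℤ) ^ N !).natAbs := by
    rw [Int.natAbs_pow, Int.natAbs_natCast]
    exact (coprime_psNumer 2 hN).pow_right (N !)
  have hpos : (0 : ℤ) < 2 ^ N ! := by positivity
  have h1 := Rat.num_div_eq_of_coprime hpos hcop
  have h2 := Rat.den_div_eq_of_coprime hpos hcop
  have hq : (((psNumer 2 N : ℕ) : ℤ) : ℚ) / (((2 : ℤ) ^ N ! : ℤ) : ℚ) = levelQ N := by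
    unfold levelQ; push_cast; rfl
  rw [hq] at h1 h2
  exact ⟨h1, by exact_mod_cast h2⟩

/-- `levelRes ℓ N = p_N / 2^{N!}` in `𝔽_ℓ` (`N ≥ 2`). -/
theorem levelRes_eq {ℓ : ℕ} [Fact ℓ.Prime] {N : ℕ} (hN : 2 ≤ N) :
    levelRes ℓ N = ((psNumer 2 N : ℕ) : ZMod ℓ) / (2 : ZMod ℓ) ^ N ! := by
  obtain ⟨h1, h2⟩ := levelQ_num_den hN
  unfold levelRes
  rw [h1, h2]
  push_cast
  rfl

/-- `2 ≠ 0` in `𝔽_ℓ` for an odd prime `ℓ`. -/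
theorem two_ne_zero_zmod {ℓ : ℕ} [Fact ℓ.Prime] (hℓ : ℓ ≠ 2) : (2 : ZMod ℓ) ≠ 0 := by
  intro h
  have h' : ((2 : ℕ) : ZMod ℓ) = 0 := by exact_mod_cast h
  rw [ZMod.natCast_eq_zero_iff] at h'
  exact hℓ ((Nat.prime_dvd_prime_iff_eq Fact.out Nat.prime_two).mp h')

/-- Fermat exponent reduction: `2^n = 2^{n mod (ℓ−1)}` in `𝔽_ℓ`. -/
theorem two_pow_eq_pow_mod {ℓ : ℕ} [Fact ℓ.Prime] (hℓ : ℓ ≠ 2) (n : ℕ) :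
    (2 : ZMod ℓ) ^ n = (2 : ZMod ℓ) ^ (n % (ℓ - 1)) := by
  conv_lhs => rw [← Nat.mod_add_div n (ℓ - 1)]
  rw [pow_add, pow_mul, ZMod.pow_card_sub_one_eq_one (two_ne_zero_zmod hℓ), one_pow, mul_one]

/-- `2^n = 1` in `𝔽_ℓ` when `ℓ − 1 ∣ n`. -/
theorem two_pow_eq_one_of_dvd {ℓ : ℕ} [Fact ℓ.Prime] (hℓ : ℓ ≠ 2) {n : ℕ} (h : ℓ - 1 ∣ n) :
    (2 : ZMod ℓ) ^ n = 1 := by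
  obtain ⟨q, rfl⟩ := h
  rw [pow_mul, ZMod.pow_card_sub_one_eq_one (two_ne_zero_zmod hℓ), one_pow]

/-- **`2^{N!} ≡ 1 (mod ℓ)` for `N ≥ ℓ − 1`.** -/
theorem two_pow_factorial {ℓ : ℕ} [Fact ℓ.Prime] (hℓ : ℓ ≠ 2) {N : ℕ} (hN : ℓ - 1 ≤ N) :
    (2 : ZMod ℓ) ^ N ! = 1 :=
  two_pow_eq_one_of_dvd hℓ (Nat.dvd_factorial (by have := (Fact.out : ℓ.Prime).two_le; omega) hN)

/-- The shift `B_ℓ = 2 + Σ_{i < ℓ−1} 2^{(ℓ−1) − (i! mod (ℓ−1))} ∈ 𝔽_ℓ` (inverse-free form of `2 + Σ_{i<ℓ−1} 2^{−i!}`). -/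
def Bshift (ℓ : ℕ) : ZMod ℓ := 2 + ∑ i ∈ Finset.range (ℓ - 1), (2 : ZMod ℓ) ^ (ℓ - 1 - i ! % (ℓ - 1))

/-- **THE ARITHMETIC-PROGRESSION LAW: `p_N ≡ N + B_ℓ (mod ℓ)` for every `N ≥ ℓ − 1`** (`ℓ` an odd prime). -/
theorem psNumer_two_zmod {ℓ : ℕ} [Fact ℓ.Prime] (hℓ : ℓ ≠ 2) {N : ℕ} (hN : ℓ - 1 ≤ N) :
    ((psNumer 2 N : ℕ) : ZMod ℓ) = (N : ZMod ℓ) + Bshift ℓ := by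
  have hℓ1 : 0 < ℓ - 1 := by have := (Fact.out : ℓ.Prime).two_le; omega
  have h2 := two_ne_zero_zmod hℓ
  have hdN : ℓ - 1 ∣ N ! := Nat.dvd_factorial hℓ1 hN
  unfold psNumer
  push_cast
  rw [← Finset.sum_range_add_sum_Ico _ (show ℓ - 1 ≤ N + 1 by omega)]
  have hA : ∀ i ∈ Finset.range (ℓ - 1),
      (2 : ZMod ℓ) ^ (N.factorial - i.factorial) = (2 : ZMod ℓ) ^ (ℓ - 1 - i ! % (ℓ - 1)) := by
    intro i hi
    have hiN : i ≤ N := by have := Finset.mem_range.mp hi; omega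
    have hfac : i ! ≤ N ! := Nat.factorial_le hiN
    refine mul_right_cancel₀ (pow_ne_zero (i !) h2) ?_
    rw [← pow_add, Nat.sub_add_cancel hfac, two_pow_eq_one_of_dvd hℓ hdN, ← pow_add]
    refine (two_pow_eq_one_of_dvd hℓ ⟨i ! / (ℓ - 1) + 1, ?_⟩).symm
    have hm := Nat.mod_add_div (i !) (ℓ - 1)
    have hlt := Nat.mod_lt (i !) hℓ1
    rw [Nat.mul_add, mul_one]
    omega
  have hB : ∀ i ∈ Finset.Ico (ℓ - 1) (N + 1), (2 : ZMod ℓ) ^ (N.factorial - i.factorial) = 1 := by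
    intro i hi
    exact two_pow_eq_one_of_dvd hℓ (Nat.dvd_sub hdN (Nat.dvd_factorial hℓ1 (Finset.mem_Ico.mp hi).1))
  rw [Finset.sum_congr rfl hA, Finset.sum_congr rfl hB, Finset.sum_const, Nat.card_Ico, Nat.smul_one_eq_cast]
  have hc : ((N + 1 - (ℓ - 1) : ℕ) : ZMod ℓ) = (N : ZMod ℓ) + 2 := by
    have h : N + 1 - (ℓ - 1) + ℓ = N + 2 := by omega
    have h' := congrArg (Nat.cast : ℕ → ZMod ℓ) h
    push_cast at h'
    rw [ZMod.natCast_self, add_zero] at h'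
    exact h'
  rw [hc, Bshift]
  ring

/-- **`s_N ≡ N + B_ℓ (mod ℓ)` for `N ≥ ℓ − 1`:** the level residues are an arithmetic progression of step `1`. -/
theorem levelRes_eq_AP {ℓ : ℕ} [Fact ℓ.Prime] (hℓ : ℓ ≠ 2) {N : ℕ} (hN : ℓ - 1 ≤ N) :
    levelRes ℓ N = (N : ZMod ℓ) + Bshift ℓ := by
  have h2N : 2 ≤ N := le_trans (by have := (Fact.out : ℓ.Prime).two_le; omega) hN
  rw [levelRes_eq h2N, two_pow_factorial hℓ hN, div_one, psNumer_two_zmod hℓ hN]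

/-- Small-exponent form of the residue (any `N ≥ 2`): `levelRes · 2^{N! mod (ℓ−1)} = Σ_{i ≤ N} 2^{(N! − i!) mod (ℓ−1)}`. -/
theorem levelRes_mul_pow {ℓ : ℕ} [Fact ℓ.Prime] (hℓ : ℓ ≠ 2) {N : ℕ} (hN : 2 ≤ N) :
    levelRes ℓ N * (2 : ZMod ℓ) ^ (N ! % (ℓ - 1)) =
      ∑ i ∈ Finset.range (N + 1), (2 : ZMod ℓ) ^ ((N.factorial - i.factorial) % (ℓ - 1)) := by
  rw [levelRes_eq hN, ← two_pow_eq_pow_mod hℓ, div_mul_cancel₀ _ (pow_ne_zero _ (two_ne_zero_zmod hℓ))]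
  unfold psNumer
  push_cast
  exact Finset.sum_congr rfl fun i _ => two_pow_eq_pow_mod hℓ _

/-- Direct evaluation: a certificate `Σ_{i ≤ N} 2^{(N!−i!) mod (ℓ−1)} = a · 2^{N! mod (ℓ−1)}` gives `levelRes ℓ N = a`. -/
theorem levelRes_eq_of_sum {ℓ : ℕ} [Fact ℓ.Prime] (hℓ : ℓ ≠ 2) {N : ℕ} (hN : 2 ≤ N) {a : ZMod ℓ}
    (ha : ∑ i ∈ Finset.range (N + 1), (2 : ZMod ℓ) ^ ((N.factorial - i.factorial) % (ℓ - 1)) =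
      a * (2 : ZMod ℓ) ^ (N ! % (ℓ - 1))) : levelRes ℓ N = a :=
  mul_right_cancel₀ (pow_ne_zero _ (two_ne_zero_zmod hℓ)) ((levelRes_mul_pow hℓ hN).trans ha)

/-- Level `1`: `s_1 = 1`, residue `1`. -/
theorem levelRes_one {ℓ : ℕ} [Fact ℓ.Prime] : levelRes ℓ 1 = 1 := by
  have h : levelQ 1 = 1 := by
    unfold levelQ psNumer
    norm_num [Finset.sum_range_succ]
  unfold levelRes
  rw [h, Rat.num_ofNat, Rat.den_ofNat]
  simp

/-- **The AP law through the engine (any curve):** an empty fibre at `N + B_ℓ` empties every level `N ≥ ℓ − 1` of that class. -/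
theorem no_level_of_fibreEmptyAt_AP {ℓ : ℕ} (hprime : ℓ.Prime) (hℓ : ℓ ≠ 2) {P : ℤ[X][X]} {N : ℕ}
    (hN : ℓ - 1 ≤ N) (h : FibreEmptyAt ℓ P ((N : ZMod ℓ) + Bshift ℓ)) (r : ℚ) :
    bev P (partialSum 2 N) r ≠ 0 := by
  haveI := Fact.mk hprime
  refine no_level_of_fibreEmptyAt ?_ hℓ r
  rw [levelRes_eq_AP hℓ hN]
  exact h

end Summit.Schanuel.Schanuel.Theorems.RootDecomp1KLevelSieve
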